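import Mathlib.Combinatorics.SetFamily.HarrisKleitman
import Mathlib.Data.Finset.Sups
import Summits.CriticalPhenomena.PercolationContinuityZ3.Theorems.PercNearOneGluingNoHeavyLowerTailSahiGridPatternZProfile

/-!
Copyright: this project. [this work]
Cell prim-sahi (crux stmt-CriticalPhenomena-4575 adjacent), literature seat gen51.

# The abstract claim AC(t,t') of the top-cube programme — the chart pairs with `min(t,t') = 0`

prim-sahi-p1 gen18 (memo FROM-prim-sahi-p1-gen18-ORTHANT-HARRIS.md §0 (I-e)) reduced its Conjecture B
(every top-cube up-set of `[3]^k` is a G-good slot of the pattern inequality, every `k`) to an abstract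
inequality `AC(t,t')` about monotone Boolean functions on `2^[t] × 2^[t']`, one instance per chart pair
`{T, Tᶜ}`, `|T| = t`.  prim-sahi-census gen23 (CENSUS §49) observed that for `t = 0` the claim is
equivalent to: for all up-families `𝒰, ℬ, 𝒞 ⊆ 2^[k]`,
`∑_{S ∈ 𝒰} (2·1_ℬ(S)1_𝒞(S) − 1_ℬ(S)1_𝒞(Sᶜ) − 1_ℬ(Sᶜ)1_𝒞(S)) ≥ 0`,
and verified it exhaustively for `k ≤ 5`.

This file proves that statement for EVERY finite ground set (`ac_zero_chartPair`), by two applications of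
the Harris–Kleitman inequality per cross term (`card_inter_lower_le_card_inter_upper`,
`card_inter_compls_le_card_inter`): for up-families `𝒱, 𝒲`,  `#(𝒱 ∩ 𝒲ᶜˢ) ≤ #(𝒱 ∩ 𝒲)`
(an up-family meets another up-family at least as often as it meets its reflection), applied with
`𝒱 = 𝒰 ∩ ℬ`, `𝒲 = 𝒞` and with `𝒱 = 𝒰 ∩ 𝒞`, `𝒲 = ℬ`.

The tool lemma `card_inter_lower_le_card_inter_upper` (for an up-family `𝒱`, a down-family `𝒟` and an
up-family `𝒲` with `#𝒟 ≤ #𝒲`: `#(𝒱 ∩ 𝒟) ≤ #(𝒱 ∩ 𝒲)`) is the bookkeeping device of the whole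
programme: it is Kleitman's lemma [Kleitman 1966] chained with Harris's inequality through `#𝒱·#𝒟/2^k`.

Tree neighbours (not duplicated here): `AntiBandDegenerate.card_inter_le_card_compls_inter` (`#(N ∩ V) ≤ #(Nᶜˢ ∩ V)`,
N lower, V upper — the reflection form with the lower family named), `AntiBandDegenerate.isUpperSet_compls_of_isLowerSet`,
and `SahiGridPattern.isLowerSet_compls` (the reflection of an up-family is a down-family; imported and reused here);
the Erdős–Herzog–Schönheim bijection of a down-set onto its complements (the matching form of the same inequality,
via Hall) is `Literature.Combinatorics.SetFamily.exists_bijOn_compl_superset_of_isLowerSet`.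

No definitions, no `sorry`, standard axioms.
-/

namespace Summit.CriticalPhenomena.PercolationContinuityZ3.Theorems.SahiACChartPair

open Finset
open scoped FinsetFamily

variable {α : Type*} [DecidableEq α] [Fintype α]

/-- **Chained Kleitman–Harris.**  For an up-family `𝒱`, a down-family `𝒟` and an up-family `𝒲` of
subsets of a finite set with `#𝒟 ≤ #𝒲`:  `#(𝒱 ∩ 𝒟) ≤ #(𝒱 ∩ 𝒲)`.
Proof: `2^k·#(𝒱 ∩ 𝒟) ≤ #𝒱·#𝒟 ≤ #𝒱·#𝒲 ≤ 2^k·#(𝒱 ∩ 𝒲)` (Kleitman, then Harris). [this work] -/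
theorem card_inter_lower_le_card_inter_upper {𝒱 𝒟 𝒲 : Finset (Finset α)}
    (h𝒱 : IsUpperSet (𝒱 : Set (Finset α))) (h𝒟 : IsLowerSet (𝒟 : Set (Finset α)))
    (h𝒲 : IsUpperSet (𝒲 : Set (Finset α))) (hcard : #𝒟 ≤ #𝒲) :
    #(𝒱 ∩ 𝒟) ≤ #(𝒱 ∩ 𝒲) := by
  have h1 : 2 ^ Fintype.card α * #(𝒱 ∩ 𝒟) ≤ #𝒱 * #𝒟 := h𝒱.card_inter_le_finset h𝒟
  have h2 : #𝒱 * #𝒟 ≤ #𝒱 * #𝒲 := Nat.mul_le_mul_left _ hcard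
  have h3 : #𝒱 * #𝒲 ≤ 2 ^ Fintype.card α * #(𝒱 ∩ 𝒲) := h𝒱.le_card_inter_finset h𝒲
  have hpos : 0 < 2 ^ Fintype.card α := Nat.two_pow_pos _
  exact Nat.le_of_mul_le_mul_left (h1.trans (h2.trans h3)) hpos

/-- An up-family meets another up-family at least as often as it meets its reflection:
`#(𝒱 ∩ 𝒲ᶜˢ) ≤ #(𝒱 ∩ 𝒲)` for up-families `𝒱, 𝒲`. [this work] -/
theorem card_inter_compls_le_card_inter {𝒱 𝒲 : Finset (Finset α)}
    (h𝒱 : IsUpperSet (𝒱 : Set (Finset α))) (h𝒲 : IsUpperSet (𝒲 : Set (Finset α))) :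
    #(𝒱 ∩ 𝒲ᶜˢ) ≤ #(𝒱 ∩ 𝒲) :=
  card_inter_lower_le_card_inter_upper h𝒱 (SahiGridPattern.isLowerSet_compls h𝒲) h𝒲
    (by rw [Finset.card_compls])

/-- **AC(0,k) = AC(k,0), every `k` (the chart pair `{∅,[k]}` of prim-sahi-p1 gen18's abstract claim).**
For up-families `𝒰, ℬ, 𝒞` of subsets of a finite set:
`#{S ∈ 𝒰 ∩ ℬ : Sᶜ ∈ 𝒞} + #{S ∈ 𝒰 ∩ 𝒞 : Sᶜ ∈ ℬ} ≤ 2·#(𝒰 ∩ ℬ ∩ 𝒞)`, i.e.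
`∑_{S∈𝒰} (2·1_ℬ(S)1_𝒞(S) − 1_ℬ(S)1_𝒞(Sᶜ) − 1_ℬ(Sᶜ)1_𝒞(S)) ≥ 0`
(prim-sahi-census gen23, CENSUS §49, reduced form of `AC(0,k)`; exhaustive there for `k ≤ 5`). [this work] -/
theorem ac_zero_chartPair {𝒰 ℬ 𝒞 : Finset (Finset α)}
    (h𝒰 : IsUpperSet (𝒰 : Set (Finset α))) (hℬ : IsUpperSet (ℬ : Set (Finset α)))
    (h𝒞 : IsUpperSet (𝒞 : Set (Finset α))) :
    #(𝒰 ∩ ℬ ∩ 𝒞ᶜˢ) + #(𝒰 ∩ 𝒞 ∩ ℬᶜˢ) ≤ 2 * #(𝒰 ∩ ℬ ∩ 𝒞) := by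
  have h1 : #(𝒰 ∩ ℬ ∩ 𝒞ᶜˢ) ≤ #(𝒰 ∩ ℬ ∩ 𝒞) :=
    card_inter_compls_le_card_inter (by rw [Finset.coe_inter]; exact h𝒰.inter hℬ) h𝒞
  have h2 : #(𝒰 ∩ 𝒞 ∩ ℬᶜˢ) ≤ #(𝒰 ∩ 𝒞 ∩ ℬ) :=
    card_inter_compls_le_card_inter (by rw [Finset.coe_inter]; exact h𝒰.inter h𝒞) hℬ
  have h3 : 𝒰 ∩ 𝒞 ∩ ℬ = 𝒰 ∩ ℬ ∩ 𝒞 := by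
    rw [Finset.inter_assoc, Finset.inter_comm 𝒞 ℬ, ← Finset.inter_assoc]
  rw [h3] at h2
  omega

/-- Indicator (sum) form of `ac_zero_chartPair`: with `b S = [S ∈ ℬ]`, `c S = [S ∈ 𝒞]` as naturals,
`∑_{S ∈ 𝒰} (b S · c Sᶜ + b Sᶜ · c S) ≤ 2 · ∑_{S ∈ 𝒰} b S · c S`. [this work] -/
theorem ac_zero_chartPair_sum {𝒰 ℬ 𝒞 : Finset (Finset α)}
    (h𝒰 : IsUpperSet (𝒰 : Set (Finset α))) (hℬ : IsUpperSet (ℬ : Set (Finset α)))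
    (h𝒞 : IsUpperSet (𝒞 : Set (Finset α))) :
    ∑ S ∈ 𝒰, ((if S ∈ ℬ then 1 else 0) * (if Sᶜ ∈ 𝒞 then 1 else 0)
        + (if Sᶜ ∈ ℬ then 1 else 0) * (if S ∈ 𝒞 then 1 else 0) : ℕ)
      ≤ 2 * ∑ S ∈ 𝒰, ((if S ∈ ℬ then 1 else 0) * (if S ∈ 𝒞 then 1 else 0) : ℕ) := by
  have key := ac_zero_chartPair h𝒰 hℬ h𝒞
  have e1 : #(𝒰 ∩ ℬ ∩ 𝒞ᶜˢ) = ∑ S ∈ 𝒰, ((if S ∈ ℬ then 1 else 0) * (if Sᶜ ∈ 𝒞 then 1 else 0) : ℕ) := by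
    rw [Finset.card_eq_sum_ones, Finset.inter_assoc, ← Finset.filter_mem_eq_inter, Finset.sum_filter]
    refine Finset.sum_congr rfl fun S _ => ?_
    by_cases hb : S ∈ ℬ <;> by_cases hc : Sᶜ ∈ 𝒞 <;> simp [hb, hc, Finset.mem_compls]
  have e2 : #(𝒰 ∩ 𝒞 ∩ ℬᶜˢ) = ∑ S ∈ 𝒰, ((if Sᶜ ∈ ℬ then 1 else 0) * (if S ∈ 𝒞 then 1 else 0) : ℕ) := by
    rw [Finset.card_eq_sum_ones, Finset.inter_assoc, ← Finset.filter_mem_eq_inter, Finset.sum_filter]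
    refine Finset.sum_congr rfl fun S _ => ?_
    by_cases hb : Sᶜ ∈ ℬ <;> by_cases hc : S ∈ 𝒞 <;> simp [hb, hc, Finset.mem_compls]
  have e3 : #(𝒰 ∩ ℬ ∩ 𝒞) = ∑ S ∈ 𝒰, ((if S ∈ ℬ then 1 else 0) * (if S ∈ 𝒞 then 1 else 0) : ℕ) := by
    rw [Finset.card_eq_sum_ones, Finset.inter_assoc, ← Finset.filter_mem_eq_inter, Finset.sum_filter]
    refine Finset.sum_congr rfl fun S _ => ?_
    by_cases hb : S ∈ ℬ <;> by_cases hc : S ∈ 𝒞 <;> simp [hb, hc]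
  rw [Finset.sum_add_distrib, ← e1, ← e2, ← e3]
  exact key

end Summit.CriticalPhenomena.PercolationContinuityZ3.Theorems.SahiACChartPair
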